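import Mathlib
import HarnessLib
import Summits.NavierStokesRegularity.NavierStokesRegularity.Theorems.TypeIQuarterGateScarEnvelopeTypeIForcedTsaiAlgSoundX
import Summits.NavierStokesRegularity.NavierStokesRegularity.Theorems.TypeIQuarterGateScarEnvelopeTypeIForcedTsaiAlgWitnessLBX8
import Summits.NavierStokesRegularity.NavierStokesRegularity.Theorems.TypeIQuarterGateScarEnvelopeTypeIForcedTsaiAlgWitnessLBX16

/-!
# ARM B lane E-exact — LARGER-BASIS Type-I rows (eng-3 g2 j319388) at the EXACT B₁₀ level, AS TREE THEOREMS: δ/M = 16.540 @8.216 · 17.908 @16.34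

Closers of kernel-checked LANEX-ALG v4 rows — EXACT level `‖ω‖_{L²(B₁₀)}` (incomplete-Beta recurrences) and EXACT residual
weight `(1+ρ)⁵`; no floor, no majorant — through `AlgRowX.sound` (`…ForcedTsaiAlgSoundX`): certified UPPER bounds on the
forced-Tsai modulus in the tree currency (`ℝ³`, weight `(1+ρ)⁵`, level on `B₁₀`).
WITNESS: ns-wall-eng-3 g2's larger-basis vectors (cell ns-wall-extremal, LANEX-ALG-LB, kit job j319388; rowF JSON sha16 50e0771775ce6370 / 1ca62a233796a0f5; certifier = cert hand ns-crc-p2 g6).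
`δ*(8.216) ≤ 135.9` (δ/M = 16.540; v3 16.987 @ 8); `δ*(16.34) ≤ 292.6` (δ/M = 17.908; v3 18.289 @ 16).
«Near-profiles this good EXIST»; UPPER bounds only; excludes nothing; nothing about NS regularity; 23843 / H3 OPEN.
-/

set_option linter.dupNamespace false

namespace Summit.NavierStokesRegularity.NavierStokesRegularity.Cruxes.ScarEnvelopeTypeI.ForcedTsai

/-- `δ*(1027/125) ≤ 27179/200` ≈ 135.8950 at the EXACT `B₁₀` level `M = 8.216` (Type-I-tail class, exact closure, exact weight; δ/M = 16.540; the v3 row of the same vector: 16.987 @ 8). -/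
theorem forcedTsaiModulusLE_algX_LBX_8 : ForcedTsaiModulusLE (1027 / 125 : ℝ) (27179 / 200 : ℝ) := by
  have h := algRowXLBX8r0.sound algRowXLBX8r0_checkX
  have hM : algRowXLBX8r0.M = (1027 / 125) := rfl
  have hδ : algRowXLBX8r0.δ = (27179 / 200) := rfl
  rw [hM, hδ] at h
  push_cast at h
  exact h

/-- `δ*(817/50) ≤ 292617/1000` ≈ 292.6170 at the EXACT `B₁₀` level `M = 16.34` (Type-I-tail class, exact closure, exact weight; δ/M = 17.908; the v3 row of the same vector: 18.289 @ 16). -/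
theorem forcedTsaiModulusLE_algX_LBX_16 : ForcedTsaiModulusLE (817 / 50 : ℝ) (292617 / 1000 : ℝ) := by
  have h := algRowXLBX16r0.sound algRowXLBX16r0_checkX
  have hM : algRowXLBX16r0.M = (817 / 50) := rfl
  have hδ : algRowXLBX16r0.δ = (292617 / 1000) := rfl
  rw [hM, hδ] at h
  push_cast at h
  exact h

/-- Rounded: `ForcedTsaiModulusLE (163/10) 293` (`δ/M ≤ 17.98` at level 16.3; larger-basis vector, exact level and exact weight). -/
theorem forcedTsaiModulusLE_16p3_293 : ForcedTsaiModulusLE (163 / 10 : ℝ) (293 : ℝ) :=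
  forcedTsaiModulusLE_algX_LBX_16.mono (by norm_num) (by norm_num)

end Summit.NavierStokesRegularity.NavierStokesRegularity.Cruxes.ScarEnvelopeTypeI.ForcedTsai
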